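import Mathlib
import Literature.Analysis.FluidPDE.VectorCalculus
import Summits.NavierStokesRegularity.NavierStokesRegularity.Theorems.FilamentSkeletonRssMatchedKernelDifferentiable

/-!
# Clause 13-R, route (ii′) item (a): DECAY INTEGRABILITY AT A STATION for the Biot–Savart variation kernels
# (crux `Clause13RNearStraightL`, stmt-NavierStokesRegularity-23612; line `rate_bordered_split`, STUB R `stub_rateRow13RFlat`)

Route `FilamentSkeletonRss`, Variant A1R.  The station-local pieces of the variation kernel of the closed form
`…Clause13LinearisedMapClauses.deriv_linearisedMap_inBall` — `(−3⟪y − Xσ, v⟫K₅)•(X′σ × (y − Xσ))`, `K₃•(X′σ × v)` and their transposes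
`(−3K₅⟪φ, X′σ × (y − Xσ)⟫)•(y − Xσ)`, `K₃•(φ × X′σ)` (`K_p = ((‖y − Xσ‖² + mσ)^{p/2})⁻¹`) — are integrable over `σ ∈ ℝ` along a proper axis
(`‖X′‖ ≤ 1`, cone growth `c|σ| − C ≤ ‖Xσ‖`) with a core floor `0 < m₀ ≤ m`: all are `O((‖y − Xσ‖² + mσ)⁻¹) = O((1 + σ²)⁻¹)`
(`MatchedKernel.inv_le_of_mem_ball`).  Used by `…Clause13RPairwiseAdjoint` (pairing identity, census item (a) of memo
STRUCTURE-23612-conformal-cokernel-leafhand8-g1.md).  Hand `leafhand-ns-filamentskeletonrs-10-g0` (LAND-ONLY); `--supports stmt-NavierStokesRegularity-23612`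
helper.  HONEST FRAMING: calculus at a HYPOTHETICAL near-straight filament skeleton on the NEGATIVE side of a MODEL blow-up route; STUB R is NOT proved
here and nothing in this file bears on Navier–Stokes regularity or blow-up.
-/

noncomputable section

open MeasureTheory Filter Topology Set
open scoped RealInnerProductSpace InnerProductSpace
open Literature.Analysis.FluidPDE
open Summit.NavierStokesRegularity.NavierStokesRegularity.Theorems.MatchedKernel (rpow_neg_three_halves_le inv_le_of_mem_ball)

namespace Summit.NavierStokesRegularity.NavierStokesRegularity.Theorems.Clause13RStationDecay
set_option linter.dupNamespace false

/-! ## §1 Decay integrability at a station -/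

/-- A continuous integrand dominated by `B·(‖y − Xσ‖² + mσ)⁻¹` along a proper axis (`c|σ| − C ≤ ‖Xσ‖`, core floor `m₀ > 0`) is integrable
over `σ ∈ ℝ` (comparison with `(1 + σ²)⁻¹`, `MatchedKernel.inv_le_of_mem_ball`). [folklore] -/
theorem integrable_of_norm_le_inv {F : ℝ → EuclideanSpace ℝ (Fin 3)} {X : ℝ → EuclideanSpace ℝ (Fin 3)} {m : ℝ → ℝ}
    {m₀ c C B : ℝ} (y : EuclideanSpace ℝ (Fin 3)) (hm₀ : 0 < m₀) (hm : ∀ σ, m₀ ≤ m σ) (hc : 0 < c)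
    (hXg : ∀ σ, c * |σ| - C ≤ ‖X σ‖) (hF : Continuous F) (hB : 0 ≤ B)
    (hFB : ∀ σ, ‖F σ‖ ≤ B * (‖y - X σ‖ ^ 2 + m σ)⁻¹) : Integrable F := by
  have hg : Integrable fun σ : ℝ => B * ((4 * m₀ + c ^ 2 + 4 * (|C| + ‖y‖ + 1) ^ 2) / (c ^ 2 * m₀)) * (1 + σ ^ 2)⁻¹ :=
    integrable_inv_one_add_sq.const_mul _
  refine hg.mono' hF.aestronglyMeasurable (Eventually.of_forall fun σ => ?_)
  have h := inv_le_of_mem_ball hm₀ hm hc hXg y (Metric.mem_ball_self one_pos) σ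
  calc ‖F σ‖ ≤ B * (‖y - X σ‖ ^ 2 + m σ)⁻¹ := hFB σ
    _ ≤ B * ((4 * m₀ + c ^ 2 + 4 * (|C| + ‖y‖ + 1) ^ 2) / (c ^ 2 * m₀) * (1 + σ ^ 2)⁻¹) :=
        mul_le_mul_of_nonneg_left h hB
    _ = _ := by ring

/-- Kernel bound: `((‖d‖² + q)^{3/2})⁻¹ ≤ (√m₀)⁻¹ (‖d‖² + q)⁻¹` for `q ≥ m₀ > 0`. [folklore] -/
theorem kernel3_le {d : EuclideanSpace ℝ (Fin 3)} {q m₀ : ℝ} (hm₀ : 0 < m₀) (hq : m₀ ≤ q) :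
    ((‖d‖ ^ 2 + q) ^ (3 / 2 : ℝ))⁻¹ ≤ (Real.sqrt m₀)⁻¹ * (‖d‖ ^ 2 + q)⁻¹ := by
  have hs : 0 < ‖d‖ ^ 2 + q := by have := hm₀.trans_le hq; positivity
  rw [← Real.rpow_neg hs.le]
  exact rpow_neg_three_halves_le hm₀ (le_trans hq (le_add_of_nonneg_left (sq_nonneg _)))

/-- Kernel bound: `‖d‖² ((‖d‖² + q)^{5/2})⁻¹ ≤ ((‖d‖² + q)^{3/2})⁻¹` for `q > 0`. [folklore] -/
theorem normSq_mul_kernel5_le {d : EuclideanSpace ℝ (Fin 3)} {q : ℝ} (hq : 0 < q) :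
    ‖d‖ ^ 2 * ((‖d‖ ^ 2 + q) ^ (5 / 2 : ℝ))⁻¹ ≤ ((‖d‖ ^ 2 + q) ^ (3 / 2 : ℝ))⁻¹ := by
  have hs : 0 < ‖d‖ ^ 2 + q := by positivity
  have hle : ‖d‖ ^ 2 ≤ ‖d‖ ^ 2 + q := le_add_of_nonneg_right hq.le
  rw [← Real.rpow_neg hs.le, ← Real.rpow_neg hs.le]
  have hsplit : (‖d‖ ^ 2 + q) ^ (-(3 / 2) : ℝ) = (‖d‖ ^ 2 + q) * (‖d‖ ^ 2 + q) ^ (-(5 / 2) : ℝ) := by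
    rw [show (-(3 / 2) : ℝ) = 1 + -(5 / 2) by norm_num, Real.rpow_add hs, Real.rpow_one]
  rw [hsplit]
  exact mul_le_mul_of_nonneg_right hle (Real.rpow_nonneg hs.le _)

/-- Pointwise bound for `K₃ • (a × v)`, `‖a‖ ≤ 1`. [folklore] -/
theorem norm_kernel3_cross_le {d a v : EuclideanSpace ℝ (Fin 3)} {q m₀ : ℝ} (hm₀ : 0 < m₀) (hq : m₀ ≤ q) (ha : ‖a‖ ≤ 1) :
    ‖((‖d‖ ^ 2 + q) ^ (3 / 2 : ℝ))⁻¹ • cross a v‖ ≤ (‖v‖ * (Real.sqrt m₀)⁻¹) * (‖d‖ ^ 2 + q)⁻¹ := by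
  have hs : 0 < ‖d‖ ^ 2 + q := by have := hm₀.trans_le hq; positivity
  have hk : 0 ≤ ((‖d‖ ^ 2 + q) ^ (3 / 2 : ℝ))⁻¹ := inv_nonneg.2 (Real.rpow_nonneg hs.le _)
  rw [norm_smul, Real.norm_of_nonneg hk]
  calc ((‖d‖ ^ 2 + q) ^ (3 / 2 : ℝ))⁻¹ * ‖cross a v‖ ≤ ((‖d‖ ^ 2 + q) ^ (3 / 2 : ℝ))⁻¹ * ‖v‖ := by
        refine mul_le_mul_of_nonneg_left ?_ hk
        calc ‖cross a v‖ ≤ ‖a‖ * ‖v‖ := norm_cross_le_norm_mul_norm a v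
          _ ≤ 1 * ‖v‖ := mul_le_mul_of_nonneg_right ha (norm_nonneg _)
          _ = ‖v‖ := one_mul _
    _ ≤ (Real.sqrt m₀)⁻¹ * (‖d‖ ^ 2 + q)⁻¹ * ‖v‖ := mul_le_mul_of_nonneg_right (kernel3_le hm₀ hq) (norm_nonneg _)
    _ = _ := by ring

/-- Pointwise bound for `K₃ • (φ × a)`, `‖a‖ ≤ 1`. [folklore] -/
theorem norm_kernel3_cross_le' {d a φ : EuclideanSpace ℝ (Fin 3)} {q m₀ : ℝ} (hm₀ : 0 < m₀) (hq : m₀ ≤ q) (ha : ‖a‖ ≤ 1) :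
    ‖((‖d‖ ^ 2 + q) ^ (3 / 2 : ℝ))⁻¹ • cross φ a‖ ≤ (‖φ‖ * (Real.sqrt m₀)⁻¹) * (‖d‖ ^ 2 + q)⁻¹ := by
  have hs : 0 < ‖d‖ ^ 2 + q := by have := hm₀.trans_le hq; positivity
  have hk : 0 ≤ ((‖d‖ ^ 2 + q) ^ (3 / 2 : ℝ))⁻¹ := inv_nonneg.2 (Real.rpow_nonneg hs.le _)
  rw [norm_smul, Real.norm_of_nonneg hk]
  calc ((‖d‖ ^ 2 + q) ^ (3 / 2 : ℝ))⁻¹ * ‖cross φ a‖ ≤ ((‖d‖ ^ 2 + q) ^ (3 / 2 : ℝ))⁻¹ * ‖φ‖ := by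
        refine mul_le_mul_of_nonneg_left ?_ hk
        calc ‖cross φ a‖ ≤ ‖φ‖ * ‖a‖ := norm_cross_le_norm_mul_norm φ a
          _ ≤ ‖φ‖ * 1 := mul_le_mul_of_nonneg_left ha (norm_nonneg _)
          _ = ‖φ‖ := mul_one _
    _ ≤ (Real.sqrt m₀)⁻¹ * (‖d‖ ^ 2 + q)⁻¹ * ‖φ‖ := mul_le_mul_of_nonneg_right (kernel3_le hm₀ hq) (norm_nonneg _)
    _ = _ := by ring

/-- Pointwise bound for the `K₅` term `(−3⟪d, v⟫K₅) • (a × d)`, `‖a‖ ≤ 1`. [folklore] -/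
theorem norm_kernel5_term_le {d a v : EuclideanSpace ℝ (Fin 3)} {q m₀ : ℝ} (hm₀ : 0 < m₀) (hq : m₀ ≤ q) (ha : ‖a‖ ≤ 1) :
    ‖(-3 * ⟪d, v⟫ * ((‖d‖ ^ 2 + q) ^ (5 / 2 : ℝ))⁻¹) • cross a d‖ ≤ (3 * ‖v‖ * (Real.sqrt m₀)⁻¹) * (‖d‖ ^ 2 + q)⁻¹ := by
  have hq0 : 0 < q := hm₀.trans_le hq
  have hs : 0 < ‖d‖ ^ 2 + q := by positivity
  have hk5 : 0 ≤ ((‖d‖ ^ 2 + q) ^ (5 / 2 : ℝ))⁻¹ := inv_nonneg.2 (Real.rpow_nonneg hs.le _)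
  have hcr : ‖cross a d‖ ≤ ‖d‖ := by
    calc ‖cross a d‖ ≤ ‖a‖ * ‖d‖ := norm_cross_le_norm_mul_norm a d
      _ ≤ 1 * ‖d‖ := mul_le_mul_of_nonneg_right ha (norm_nonneg _)
      _ = ‖d‖ := one_mul _
  have hin : |⟪d, v⟫| ≤ ‖d‖ * ‖v‖ := abs_real_inner_le_norm d v
  rw [norm_smul, Real.norm_eq_abs, abs_mul, abs_mul, abs_of_nonneg hk5, show |(-3 : ℝ)| = 3 by norm_num]
  calc 3 * |⟪d, v⟫| * ((‖d‖ ^ 2 + q) ^ (5 / 2 : ℝ))⁻¹ * ‖cross a d‖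
      ≤ 3 * (‖d‖ * ‖v‖) * ((‖d‖ ^ 2 + q) ^ (5 / 2 : ℝ))⁻¹ * ‖d‖ := by
        gcongr
    _ = 3 * ‖v‖ * (‖d‖ ^ 2 * ((‖d‖ ^ 2 + q) ^ (5 / 2 : ℝ))⁻¹) := by ring
    _ ≤ 3 * ‖v‖ * ((‖d‖ ^ 2 + q) ^ (3 / 2 : ℝ))⁻¹ :=
        mul_le_mul_of_nonneg_left (normSq_mul_kernel5_le hq0) (by positivity)
    _ ≤ 3 * ‖v‖ * ((Real.sqrt m₀)⁻¹ * (‖d‖ ^ 2 + q)⁻¹) :=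
        mul_le_mul_of_nonneg_left (kernel3_le hm₀ hq) (by positivity)
    _ = _ := by ring

/-- Pointwise bound for the transposed `K₅` term `(−3K₅⟪φ, a × d⟫) • d`, `‖a‖ ≤ 1`. [folklore] -/
theorem norm_kernel5_term_le' {d a φ : EuclideanSpace ℝ (Fin 3)} {q m₀ : ℝ} (hm₀ : 0 < m₀) (hq : m₀ ≤ q) (ha : ‖a‖ ≤ 1) :
    ‖(-3 * ((‖d‖ ^ 2 + q) ^ (5 / 2 : ℝ))⁻¹ * ⟪φ, cross a d⟫) • d‖ ≤ (3 * ‖φ‖ * (Real.sqrt m₀)⁻¹) * (‖d‖ ^ 2 + q)⁻¹ := by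
  have hq0 : 0 < q := hm₀.trans_le hq
  have hs : 0 < ‖d‖ ^ 2 + q := by positivity
  have hk5 : 0 ≤ ((‖d‖ ^ 2 + q) ^ (5 / 2 : ℝ))⁻¹ := inv_nonneg.2 (Real.rpow_nonneg hs.le _)
  have hin : |⟪φ, cross a d⟫| ≤ ‖φ‖ * ‖d‖ := by
    calc |⟪φ, cross a d⟫| ≤ ‖φ‖ * ‖cross a d‖ := abs_real_inner_le_norm φ _
      _ ≤ ‖φ‖ * (‖a‖ * ‖d‖) := mul_le_mul_of_nonneg_left (norm_cross_le_norm_mul_norm a d) (norm_nonneg _)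
      _ ≤ ‖φ‖ * (1 * ‖d‖) := by gcongr
      _ = ‖φ‖ * ‖d‖ := by rw [one_mul]
  rw [norm_smul, Real.norm_eq_abs, abs_mul, abs_mul, abs_of_nonneg hk5, show |(-3 : ℝ)| = 3 by norm_num]
  calc 3 * ((‖d‖ ^ 2 + q) ^ (5 / 2 : ℝ))⁻¹ * |⟪φ, cross a d⟫| * ‖d‖
      ≤ 3 * ((‖d‖ ^ 2 + q) ^ (5 / 2 : ℝ))⁻¹ * (‖φ‖ * ‖d‖) * ‖d‖ := by gcongr
    _ = 3 * ‖φ‖ * (‖d‖ ^ 2 * ((‖d‖ ^ 2 + q) ^ (5 / 2 : ℝ))⁻¹) := by ring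
    _ ≤ 3 * ‖φ‖ * ((‖d‖ ^ 2 + q) ^ (3 / 2 : ℝ))⁻¹ :=
        mul_le_mul_of_nonneg_left (normSq_mul_kernel5_le hq0) (by positivity)
    _ ≤ 3 * ‖φ‖ * ((Real.sqrt m₀)⁻¹ * (‖d‖ ^ 2 + q)⁻¹) :=
        mul_le_mul_of_nonneg_left (kernel3_le hm₀ hq) (by positivity)
    _ = _ := by ring

/-- Continuity of the scalar kernels `σ ↦ ((‖y − Xσ‖² + mσ)^{p})⁻¹` along a `C¹` axis with a continuous positive core. [folklore] -/
theorem continuous_kernel {X : ℝ → EuclideanSpace ℝ (Fin 3)} {m : ℝ → ℝ} (hXc : Continuous X) (hmc : Continuous m)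
    (hmpos : ∀ σ, 0 < m σ) (y : EuclideanSpace ℝ (Fin 3)) (p : ℝ) :
    Continuous fun σ => ((‖y - X σ‖ ^ 2 + m σ) ^ p)⁻¹ := by
  have hs : Continuous fun σ => ‖y - X σ‖ ^ 2 + m σ := ((continuous_const.sub hXc).norm.pow 2).add hmc
  have hpos : ∀ σ, 0 < ‖y - X σ‖ ^ 2 + m σ := fun σ => by have := hmpos σ; positivity
  exact (hs.rpow_const fun σ => Or.inl (hpos σ).ne').inv₀ fun σ => (Real.rpow_pos_of_pos (hpos σ) _).ne'

end Summit.NavierStokesRegularity.NavierStokesRegularity.Theorems.Clause13RStationDecay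

end
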